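import Summits.QuantumAdvantage.QuantumAdvantage.Theorems.MobiusLadderLiouvilleNotPPolyTwinKernel
import Literature.Computability.Complexity.CodeFPArith
import Literature.Computability.Complexity.CircuitEval
import Literature.Computability.Complexity.MurrayWilliams2018AlmostAE

/-!
# Eventual polynomial-bit Liouville twins put `L_λ` in `P/poly` (stub `stub_twinsRefute`, T1c of
line `Sketch` for the crux `MobiusLadder.LiouvilleNotPPoly`, stmt-QuantumAdvantage-1389)

Helper file (continuation lead c2, line `Sketch`, idea `twin-exclusion-rigidity`). Given

* the Jacobi symbol `(a | b)` computed on codes in polynomial time (T1a, a hypothesis here),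
* the `2`-adic split `N ↦ (N / 2^{v₂(N)}, v₂(N) mod 2)` computed on codes in polynomial time
  (T1b, a hypothesis here), and
* eventual polynomial twins: some `k` and, for all large `n`, an integer `d_n` with
  `|d_n| ≤ 2^{n^k}` and `(d_n | p) = −1` at every odd prime `p ≤ 2^n`,

the Liouville language `L_λ = {bin N : λ(N) = −1}` is in `P/poly`: the advice at length `n` is
the difference-pair code of `d_n` (`≤ 3 n^k + 5` symbols); the polynomial-time evaluator reads an
`n`-bit canonical numeral `N = 2^v · M` (`M` odd, `M ≤ N < 2^n`) and accepts iff
`(−1)^v (d_n | M) = −1`, which is `λ(N) = −1` because twins compute `λ` on the odd numbers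
below their level (`jacobiSym_eq_liouville_of_twin`). This puts a language agreeing with `L_λ` on all
long words in `P/poly-advice = P/poly` (`PPoly_eq_polyAdvice_P_holds`); the finitely many short
lengths are patched through `mem_SIZE_iff_circuitSize_le_holds` (raise the size polynomial by a
constant).

Read contrapositively: any proof of the crux `L_λ ∉ P/poly` proves a least-non-inert-prime
theorem at every polynomial bit budget. Theorems only; sorry-free.
-/

set_option linter.dupNamespace false -- D-0017: single-problem summit ⇒ `QuantumAdvantage.QuantumAdvantage` by design

noncomputable section

namespace Summit.QuantumAdvantage.QuantumAdvantage.Theorems.LiouvilleNotPPoly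

open _root_.Computability Literature.Computability.Complexity Filter Polynomial

namespace TwinsRefute

open Literature.Computability.Complexity.Brick
open Literature.Computability.Complexity.CodeFP (pairE strE natE intE bitE)

/-! ### Arithmetic: reading `λ` from a twin through the `2`-adic split -/

/-- `(−1)^v` is `−1` exactly when `v` is odd (`Nat.bodd`). -/
theorem neg_one_pow_eq_bodd (v : ℕ) : (-1 : ℤ) ^ v = if Nat.bodd v then -1 else 1 := by
  induction v with
  | zero => simp
  | succ v ih => rw [pow_succ, ih, Nat.bodd_succ]; cases Nat.bodd v <;> simp

/-- The odd part `N / 2^{v₂(N)}` of a nonzero `N` is odd. -/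
theorem odd_div_two_pow_padicValNat {N : ℕ} (hN : N ≠ 0) : Odd (N / 2 ^ padicValNat 2 N) := by
  rw [← Nat.not_even_iff_odd]
  intro heven
  apply pow_succ_padicValNat_not_dvd (p := 2) hN
  obtain ⟨c, hc⟩ := heven.two_dvd
  have h := Nat.div_mul_cancel (pow_padicValNat_dvd (p := 2) (n := N))
  refine ⟨c, ?_⟩
  calc N = N / 2 ^ padicValNat 2 N * 2 ^ padicValNat 2 N := h.symm
    _ = 2 * c * 2 ^ padicValNat 2 N := by rw [hc]
    _ = 2 ^ (padicValNat 2 N + 1) * c := by ring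

/-- **The acceptance test is correct below the level of the twin**: for a twin `d` of level `x`
and `0 < N ≤ x`, writing `N = 2^v · M` with `v = v₂(N)`:
`(−1)^{v} · (d | M) = −1 ↔ λ(N) = −1` (`λ(N) = (−1)^v λ(M)` and `(d | M) = λ(M)` by
`jacobiSym_eq_liouville_of_twin`, `M` being odd and `≤ x`; the sign is spelt `if bodd v …`, the
form in which the evaluator computes it). -/
theorem sign_mul_jacobiSym_eq_neg_one_iff {d : ℤ} {x N : ℕ}
    (hd : ∀ p : ℕ, p.Prime → p ≠ 2 → p ≤ x → jacobiSym d p = -1) (hN : N ≠ 0)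
    (hNx : N ≤ x) :
    (if Nat.bodd (padicValNat 2 N) then (-1 : ℤ) else 1) *
        jacobiSym d (N / 2 ^ padicValNat 2 N) = -1 ↔
      ArithmeticFunction.liouville N = -1 := by
  set v := padicValNat 2 N with hv
  set M := N / 2 ^ v with hM
  have hsplit : 2 ^ v * M = N := by
    rw [hM, mul_comm]
    exact Nat.div_mul_cancel pow_padicValNat_dvd
  have hM0 : M ≠ 0 := by
    intro h0
    rw [h0, mul_zero] at hsplit
    exact hN hsplit.symm
  have hMx : M ≤ x := (Nat.div_le_self _ _).trans hNx
  have hjac : jacobiSym d M = ArithmeticFunction.liouville M :=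
    jacobiSym_eq_liouville_of_twin hd M hM0 (odd_div_two_pow_padicValNat hN) hMx
  have hLN : ArithmeticFunction.liouville N = (-1) ^ v * ArithmeticFunction.liouville M := by
    rw [← hsplit, ArithmeticFunction.liouville_apply_mul,
      ArithmeticFunction.liouville_apply (pow_ne_zero v two_ne_zero),
      ArithmeticFunction.cardFactors_apply_prime_pow Nat.prime_two]
  rw [hjac, hLN, neg_one_pow_eq_bodd]

/-- The acceptance test rejects `N = 0` (`v₂(0) = 0`, `(d | 0) = 1`). -/
theorem sign_mul_jacobiSym_zero_ne (d : ℤ) :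
    (if Nat.bodd (padicValNat 2 0) then (-1 : ℤ) else 1) *
        jacobiSym d (0 / 2 ^ padicValNat 2 0) ≠ -1 := by
  simp [jacobiSym.zero_right]

/-! ### The evaluator bit and its polynomial-time computability on codes -/

/-- **The evaluator bit is computed on codes in polynomial time** (strings coded by themselves,
`pairE strE strE (x, adv) = ⟨x, adv⟩`): on `(x, adv)` it is
`[bin ⟦x⟧ = x ∧ (−1)^{v₂(⟦x⟧)} · (ival adv | ⟦x⟧ / 2^{v₂(⟦x⟧)}) = −1]`, assembled from the
Jacobi symbol and the `2`-adic split on codes by typed `CodeFP` plumbing (`strVal`, `strOfNat`, `eq`,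
`zcanonF`, `ite`, `intMul`, `intEq`, `and`). -/
theorem codeFP_evalBit
    (hJ : CodeFP (pairE intE natE) intE (fun q : ℤ × ℕ => jacobiSym q.1 q.2))
    (hS : CodeFP natE (pairE natE bitE)
      (fun N : ℕ => (N / 2 ^ padicValNat 2 N, Nat.bodd (padicValNat 2 N)))) :
    CodeFP (pairE strE strE) bitE (fun p : List Bool × List Bool =>
      decide (encodeNat (bitsToNat p.1) = p.1) &&
        decide ((if Nat.bodd (padicValNat 2 (bitsToNat p.1)) then (-1 : ℤ) else 1) *
          jacobiSym (ival p.2) (bitsToNat p.1 / 2 ^ padicValNat 2 (bitsToNat p.1)) = -1)) := by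
  have hx : CodeFP (pairE strE strE) strE (fun p : List Bool × List Bool => p.1) :=
    CodeFP.fst strE strE
  have hN : CodeFP (pairE strE strE) natE (fun p : List Bool × List Bool => bitsToNat p.1) :=
    CodeFP.strVal.comp hx
  have hcanon : CodeFP (pairE strE strE) bitE
      (fun p : List Bool × List Bool => decide (encodeNat (bitsToNat p.1) = p.1)) :=
    (CodeFP.eq (eα := strE) Function.injective_id).comp ((CodeFP.strOfNat.comp hN).pair hx)
  have hd : CodeFP (pairE strE strE) intE (fun p : List Bool × List Bool => ival p.2) :=
    (CodeFP.of_fn (eα := strE) (eβ := intE) (g := ival) zcanonF zcanonF_mem_FP zcanonF_eq).comp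
      (CodeFP.snd strE strE)
  have hsplit := hS.comp hN
  have hM : CodeFP (pairE strE strE) natE
      (fun p : List Bool × List Bool => bitsToNat p.1 / 2 ^ padicValNat 2 (bitsToNat p.1)) :=
    hsplit.fst'
  have hb : CodeFP (pairE strE strE) bitE
      (fun p : List Bool × List Bool => Nat.bodd (padicValNat 2 (bitsToNat p.1))) :=
    hsplit.snd'
  -- (no type ascriptions from here on: unifying a stated `fun p => jacobiSym …` against the
  -- composite makes the elaborator unfold the arithmetic; the shapes are fixed by `rfl` below)
  have hsgn := hb.ite (CodeFP.const (pairE strE strE) (eβ := intE) (-1 : ℤ))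
    (CodeFP.const (pairE strE strE) (eβ := intE) (1 : ℤ))
  have hj := hJ.comp (hd.pair hM)
  have hprod := CodeFP.intMul.comp (hsgn.pair hj)
  have hacc :=
    CodeFP.intEq.comp (hprod.pair (CodeFP.const (pairE strE strE) (eβ := intE) (-1 : ℤ)))
  refine (hcanon.and hacc).congr fun p => ?_
  rfl

/-- **A language cut out by an `FP` string function is in `P`**: `{w | f w = [1]} ∈ P` (normalise
the output to one bit by comparing it with `[1]`, `eqPairFn`). -/
theorem lang_mem_P {f : List Bool → List Bool} (hf : f ∈ FP) :
    ({w | f w = [true]} : Language Bool) ∈ Classes.P := by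
  refine mem_P_of_mem_FP (g := eqPairFn ∘ fanoutFn f fun _ => [true])
    (comp_mem_FP eqPairFn_mem_FP (fanoutFn_mem_FP hf (const_mem_FP _))) _ fun w => ⟨?_, ?_⟩
  · intro h
    have h' : f w = [true] := h
    simp [fanoutFn_apply, eqPairFn_boolPair, h']
  · intro h
    have h' : f w ≠ [true] := h
    simp [fanoutFn_apply, eqPairFn_boolPair, h']

/-! ### Small facts on numerals, advice length and circuits -/

/-- `|bin N| = n` forces `N < 2^n`. -/
theorem lt_two_pow_of_length_encodeNat {N n : ℕ} (h : (encodeNat N).length = n) : N < 2 ^ n :=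
  (length_encodeNat_le_iff N n).1 h.le

/-- Length of the advice: `|dpEnc d| ≤ 3 n^k + 5` when `|d| ≤ 2^{n^k}`. -/
theorem length_dpEnc_le_of_abs_le {d : ℤ} {n k : ℕ} (hd : |d| ≤ 2 ^ n ^ k) :
    (dpEnc d).length ≤ (Polynomial.C 3 * X ^ k + Polynomial.C 5 : Polynomial ℕ).eval n := by
  have h1 := length_dpEnc_le d
  have h4 : d.natAbs ≤ 2 ^ n ^ k := by
    rw [Int.abs_eq_natAbs] at hd
    exact_mod_cast hd
  have h2 : d.natAbs.size ≤ n ^ k + 1 := by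
    rw [Nat.size_le]
    calc d.natAbs ≤ 2 ^ n ^ k := h4
      _ < 2 ^ (n ^ k + 1) := Nat.pow_lt_pow_right (by norm_num) (Nat.lt_succ_self _)
  simp only [eval_add, eval_mul, eval_pow, eval_X, eval_C]
  omega

/-- **The small-length splice**: a language whose circuit complexity is polynomially bounded from
some length on is in `P/poly` (raise the polynomial by the maximum over the short lengths;
`mem_SIZE_iff_circuitSize_le_holds`). -/
theorem mem_PPoly_of_circuitSize_le_eventually {L : Language Bool} (p : Polynomial ℕ) (n₀ : ℕ)
    (h : ∀ n, n₀ ≤ n → L.circuitSize n ≤ p.eval n) : L ∈ PPoly := by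
  set K : ℕ := (Finset.range n₀).sup fun n => L.circuitSize n with hK
  have hbound : ∀ n, L.circuitSize n ≤ p.eval n + K := by
    intro n
    rcases lt_or_ge n n₀ with hn | hn
    · have : L.circuitSize n ≤ K :=
        Finset.le_sup (f := fun n => L.circuitSize n) (Finset.mem_range.2 hn)
      omega
    · have := h n hn
      omega
  have hmem : L ∈ SIZE fun n => p.eval n + K := (mem_SIZE_iff_circuitSize_le_holds L _).2 hbound
  exact Set.mem_iUnion.2 ⟨p + Polynomial.C K, SIZE_mono (fun n => by simp) hmem⟩

end TwinsRefute

open TwinsRefute in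
/-- **STUB T1c · `stub_twinsRefute` — EVENTUAL POLYNOMIAL TWINS PUT `L_λ` IN `P/poly`.** Given the
Jacobi symbol and the `2`-adic split on codes in polynomial time, and, for some `k` and all large
`n`, a twin `d_n` of level `2^n` with `|d_n| ≤ 2^{n^k}`: advice `dpEnc d_n` (`≤ 3 n^k + 5`
symbols); on an `n`-bit canonical numeral `N = 2^v · M` (`M` odd) the evaluator outputs
`[(−1)^v (d_n | M) = −1] = [λ(N) = −1]` (`jacobiSym_eq_liouville_of_twin`); this language of
`P/poly-advice = P/poly` (`PPoly_eq_polyAdvice_P_holds`) agrees with `L_λ` on all long words, and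
the finitely many short lengths are patched by `mem_SIZE_iff_circuitSize_le_holds`. -/
theorem stub_twinsRefute : Literature.Computability.Complexity.CodeFP (Literature.Computability.Complexity.CodeFP.pairE Literature.Computability.Complexity.CodeFP.intE Literature.Computability.Complexity.CodeFP.natE) Literature.Computability.Complexity.CodeFP.intE (fun q : ℤ × ℕ => jacobiSym q.1 q.2) → Literature.Computability.Complexity.CodeFP Literature.Computability.Complexity.CodeFP.natE (Literature.Computability.Complexity.CodeFP.pairE Literature.Computability.Complexity.CodeFP.natE Literature.Computability.Complexity.CodeFP.bitE) (fun N : ℕ => (N / 2 ^ padicValNat 2 N, Nat.bodd (padicValNat 2 N))) → (∃ k : ℕ, ∀ᶠ n : ℕ in Filter.atTop, ∃ d : ℤ, |d| ≤ 2 ^ n ^ k ∧ ∀ p : ℕ, p.Prime → p ≠ 2 → p ≤ 2 ^ n → jacobiSym d p = -1) → Computability.encodingNatBool.toLanguage {N : ℕ | ArithmeticFunction.liouville N = -1} ∈ Literature.Computability.Complexity.PPoly := by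
  intro hJ hS hT
  obtain ⟨k, hev⟩ := hT
  obtain ⟨n₀, hn₀⟩ := Filter.eventually_atTop.1 hev
  -- twins with the bit bound at every length (`0` below `n₀`, where nothing is claimed)
  have hex : ∀ n : ℕ, ∃ d : ℤ, |d| ≤ 2 ^ n ^ k ∧
      (n₀ ≤ n → ∀ p : ℕ, p.Prime → p ≠ 2 → p ≤ 2 ^ n → jacobiSym d p = -1) := by
    intro n
    by_cases hn : n₀ ≤ n
    · obtain ⟨d, hd, ht⟩ := hn₀ n hn
      exact ⟨d, hd, fun _ => ht⟩
    · exact ⟨0, by rw [abs_zero]; positivity, fun h => absurd h hn⟩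
  choose dseq hdabs hdtwin using hex
  -- the evaluator and its language in `P`
  obtain ⟨f, hf, hfE⟩ := codeFP_evalBit hJ hS
  set L' : Language Bool := {w | f w = [true]} with hL'
  have hL'P : L' ∈ Classes.P := lang_mem_P hf
  -- the advice and the advised language, in `P/poly-advice = P/poly`
  set a : ℕ → List Bool := fun n => Brick.dpEnc (dseq n) with ha
  set L'' : Language Bool := {x | boolPair x (a x.length) ∈ L'} with hL''
  have hL''adv : L'' ∈ polyAdvice Classes.P :=
    ⟨L', hL'P, a, Polynomial.C 3 * X ^ k + Polynomial.C 5,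
      fun n => length_dpEnc_le_of_abs_le (hdabs n), fun x => Iff.rfl⟩
  have hPP : PPoly = polyAdvice Classes.P := PPoly_eq_polyAdvice_P_holds
  rw [← hPP] at hL''adv
  obtain ⟨p, hp⟩ := Set.mem_iUnion.1 hL''adv
  have hsize : ∀ n, L''.circuitSize n ≤ p.eval n :=
    (mem_SIZE_iff_circuitSize_le_holds L'' _).1 hp
  -- agreement with `L_λ` on all lengths `≥ n₀`
  set LL : Language Bool :=
    Computability.encodingNatBool.toLanguage {N : ℕ | ArithmeticFunction.liouville N = -1}
    with hLL
  have hagree : ∀ n, n₀ ≤ n → ∀ y : List Bool, y.length = n → (y ∈ LL ↔ y ∈ L'') := by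
    intro n hn y hy
    have htw := hdtwin n hn
    have hfy : f (boolPair y (a n)) = [decide (encodeNat (bitsToNat y) = y) &&
        decide ((if Nat.bodd (padicValNat 2 (bitsToNat y)) then (-1 : ℤ) else 1) *
          jacobiSym (Brick.ival (a n)) (bitsToNat y / 2 ^ padicValNat 2 (bitsToNat y)) = -1)] :=
      hfE (y, a n)
    have hival : Brick.ival (a n) = dseq n := Brick.ival_dpEnc _
    have hmem'' : y ∈ L'' ↔ encodeNat (bitsToNat y) = y ∧
        (if Nat.bodd (padicValNat 2 (bitsToNat y)) then (-1 : ℤ) else 1) *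
          jacobiSym (dseq n) (bitsToNat y / 2 ^ padicValNat 2 (bitsToNat y)) = -1 := by
      show f (boolPair y (a y.length)) = [true] ↔ _
      rw [hy, hfy, hival]
      simp only [List.singleton_inj, Bool.and_eq_true, decide_eq_true_eq]
    have hmemLL :
        y ∈ LL ↔ ∃ N : ℕ, ArithmeticFunction.liouville N = -1 ∧ encodeNat N = y := by
      show y ∈ encodingNatBool.encode '' _ ↔ _
      simp only [Set.mem_image, Set.mem_setOf_eq]
      rfl
    rw [hmem'', hmemLL]
    constructor
    · rintro ⟨N, hNS, rfl⟩
      have hN0 : N ≠ 0 := by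
        rintro rfl
        simp at hNS
      rw [bitsToNat_encodeNat]
      exact ⟨rfl, (sign_mul_jacobiSym_eq_neg_one_iff htw hN0
        (lt_two_pow_of_length_encodeNat hy).le).2 hNS⟩
    · rintro ⟨hcanon, hacc⟩
      have hN0 : bitsToNat y ≠ 0 := by
        intro h0
        rw [h0] at hacc
        exact sign_mul_jacobiSym_zero_ne _ hacc
      have hy' : (encodeNat (bitsToNat y)).length = n := by rw [hcanon, hy]
      exact ⟨bitsToNat y, (sign_mul_jacobiSym_eq_neg_one_iff htw hN0
        (lt_two_pow_of_length_encodeNat hy').le).1 hacc, hcanon⟩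
  -- splice the short lengths
  refine mem_PPoly_of_circuitSize_le_eventually p n₀ fun n hn => ?_
  rw [AlmostAE.circuitSize_eq_of_forall_iff (hagree n hn)]
  exact hsize n

end Summit.QuantumAdvantage.QuantumAdvantage.Theorems.LiouvilleNotPPoly

end
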